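import Summits.ValiantsHypothesis.ValiantsHypothesis.Theorems.LacunarySymmetroidMatrixDescartesDoorA26WallBubblingExpSumLocalSigns
import Summits.ValiantsHypothesis.ValiantsHypothesis.Theorems.LacunarySymmetroidMatrixDescartesDoorA26WallBubblingTangentPlane

/-!
# `DoorA26` / line `wall_bubbling` — LOCAL SIGNS AT A ZERO OF ANY ORDER; NULL LETTERS FORCE `det ≤ 0` (no odd-order zero)

HONEST FRAMING.  Object-search cell `pub-symmetroid`, crux `Theses.LacunarySymmetroid.DoorA26` (stmt-ValiantsHypothesis-19979; OPEN, typed,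
never asserted).  W2 seat val-sym-door-p1 g19, file #68; def-free helper for obligation (R) of `Cruxes/DoorA26/Lines/wall_bubbling.lean` (the
order-≥-3 lifts, memo `DOOR-A26-P1G19-NO-BALANCE.md` §7c: the p⋆-centred test `g = polar(p⋆, P(·))` either has total order ≤ 5 or vanishes
identically, and in the latter case every letter is `det`-orthogonal to the null vector `p⋆`, the determinant is `≤ 0` everywhere and has no zero
of odd order — contradicting a triple zero).  Imports #56 `…ExpSumLocalSigns` (orders 1, 2) and g18's `…TangentPlane` (`det_nonpos_of_polar_eq_zero`).

WHAT IS HERE.  ★ `expSum_sign_near_order`: at a zero of EXACT order `k` of `f = expSum a x` (`f^{(j)}(z) = 0` for `j < k`, `f^{(k)}(z) ≠ 0`,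
derivatives as the exponential sums with coefficients `a_i x_i^j`) the sign of `f` just right of `z` is `sgn f^{(k)}(z)` and just left is
`(−1)^k sgn f^{(k)}(z)` (induction on `k`, monotonicity of `f^{(k)}(z)·f`); `even_order_of_expSum_nonpos` / `even_order_of_expSum_nonneg`: a
one-signed exponential sum has only zeros of even exact order; `det_nonpos_of_letters_polar_eq_zero`: if a non-zero singular symmetric `p` is
`polar`-orthogonal to every letter `S l` (`det(p + S l) − det p − det(S l) = 0`) then `det(Σ_l c_l • S l) ≤ 0` for all real weights `c`.
Nothing here bears on `DoorA26`, `DoorA34`, (W)/(M)/(R), `MatrixDescartes` (18050) or `VP ≠ VNP`; registers unchanged.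

[folklore] higher-order derivative test; the tangent plane of the cone `det = 0` in `(Sym₂ℝ, det) ≅ ℝ^{1,2}` is negative semidefinite.  [this work] packaging.
-/

set_option linter.dupNamespace false

namespace Summit.ValiantsHypothesis.ValiantsHypothesis.Theorems.LacunarySymmetroidMatrixDescartes.WallBubbling

open Finset
open Bubbling (expSum hasDerivAt_expSum)

/-- ★ **Local signs at a zero of exact order `k`.**  If `f = expSum a x` has `f^{(j)}(z) = 0` for `j < k` and `c := f^{(k)}(z) ≠ 0`, then for
some `η > 0`: `0 < c · f(t)` on `(z, z + η)` and `0 < (−1)^k c · f(t)` on `(z − η, z)`. [folklore] -/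
theorem expSum_sign_near_order {ι : Type*} [Fintype ι] (x : ι → ℝ) (z : ℝ) : ∀ (k : ℕ) (a : ι → ℝ),
    (∀ j < k, expSum (fun i => a i * x i ^ j) x z = 0) → expSum (fun i => a i * x i ^ k) x z ≠ 0 →
    ∃ η > 0, (∀ t, z < t → t < z + η → 0 < expSum (fun i => a i * x i ^ k) x z * expSum a x t) ∧
      (∀ t, z - η < t → t < z → 0 < (-1) ^ k * expSum (fun i => a i * x i ^ k) x z * expSum a x t) := by
  intro k
  induction k with
  | zero =>
    intro a _ hk
    have h0 : (fun i => a i * x i ^ 0) = a := funext fun i => by simp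
    rw [h0] at hk ⊢
    -- continuity: `f z · f t > 0` near `z`
    have hcont : Continuous fun t => expSum a x z * expSum a x t := (continuous_expSum a x).const_mul _
    have hpos : 0 < expSum a x z * expSum a x z := mul_self_pos.2 hk
    obtain ⟨η, hη, hball⟩ := Metric.continuousAt_iff.1 hcont.continuousAt _ hpos
    refine ⟨η, hη, fun t h1 h2 => ?_, fun t h1 h2 => ?_⟩
    · have := hball (show dist t z < η by rw [Real.dist_eq, abs_lt]; constructor <;> linarith)
      rw [Real.dist_eq, abs_lt] at this
      linarith [this.1]
    · have := hball (show dist t z < η by rw [Real.dist_eq, abs_lt]; constructor <;> linarith)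
      rw [Real.dist_eq, abs_lt] at this
      simp only [pow_zero, one_mul]
      linarith [this.1]
  | succ k ih =>
    intro a hvan hk
    -- apply the induction hypothesis to `f′ = expSum (a · x) x`
    have hshift : ∀ j, (fun i => (fun i => a i * x i) i * x i ^ j) = fun i => a i * x i ^ (j + 1) :=
      fun j => funext fun i => by ring
    obtain ⟨η, hη, hright, hleft⟩ := ih (fun i => a i * x i) (fun j hj => by rw [hshift]; exact hvan (j + 1) (by omega))
      (by rw [hshift]; exact hk)
    rw [hshift] at hright hleft
    set c := expSum (fun i => a i * x i ^ (k + 1)) x z with hc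
    have hz : expSum a x z = 0 := by
      have := hvan 0 (Nat.succ_pos k)
      simpa using this
    have hderiv : ∀ (d s : ℝ), deriv (fun s => d * expSum a x s) s = d * expSum (fun i => a i * x i) x s := fun d s => by
      rw [deriv_const_mul _ (hasDerivAt_expSum a x s).differentiableAt, (hasDerivAt_expSum a x s).deriv]
    refine ⟨η, hη, fun t h1 h2 => ?_, fun t h1 h2 => ?_⟩
    · -- right of `z`: `c·f` increases on `[z, t]` from `0`
      have hmono : StrictMonoOn (fun s => c * expSum a x s) (Set.Icc z t) := by
        refine strictMonoOn_of_deriv_pos (convex_Icc z t) ((continuous_expSum a x).const_mul _).continuousOn ?_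
        intro s hs
        rw [interior_Icc] at hs
        rw [hderiv]
        exact hright s hs.1 (by linarith [hs.2])
      have := hmono ⟨le_refl z, h1.le⟩ ⟨h1.le, le_refl t⟩ h1
      simp only [hz, mul_zero] at this
      exact this
    · -- left of `z`: `(−1)^k c · f` increases on `[t, z]` to `0`
      have hmono : StrictMonoOn (fun s => ((-1) ^ k * c) * expSum a x s) (Set.Icc t z) := by
        refine strictMonoOn_of_deriv_pos (convex_Icc t z) ((continuous_expSum a x).const_mul _).continuousOn ?_
        intro s hs
        rw [interior_Icc] at hs
        rw [hderiv]
        exact hleft s (by linarith [hs.1]) hs.2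
      have := hmono ⟨le_refl t, h2.le⟩ ⟨h2.le, le_refl z⟩ h2
      simp only [hz, mul_zero] at this
      rw [pow_succ]
      linarith

/-- A NON-POSITIVE exponential sum has only zeros of even exact order. [folklore] -/
theorem even_order_of_expSum_nonpos {ι : Type*} [Fintype ι] (a x : ι → ℝ) (hle : ∀ t, expSum a x t ≤ 0) (z : ℝ) (k : ℕ)
    (hvan : ∀ j < k, expSum (fun i => a i * x i ^ j) x z = 0) (hk : expSum (fun i => a i * x i ^ k) x z ≠ 0) : Even k := by
  obtain ⟨η, hη, hright, hleft⟩ := expSum_sign_near_order x z k a hvan hk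
  set c := expSum (fun i => a i * x i ^ k) x z
  have h1 := hright (z + η / 2) (by linarith) (by linarith)
  have h2 := hleft (z - η / 2) (by linarith) (by linarith)
  have hf1 : expSum a x (z + η / 2) < 0 := lt_of_le_of_ne (hle _) fun h => by simp [h] at h1
  have hf2 : expSum a x (z - η / 2) < 0 := lt_of_le_of_ne (hle _) fun h => by simp [h] at h2
  have hc : c < 0 := by
    by_contra h; push Not at h
    nlinarith
  by_contra hodd
  rw [Nat.not_even_iff_odd] at hodd
  rw [hodd.neg_one_pow] at h2
  nlinarith

/-- A NON-NEGATIVE exponential sum has only zeros of even exact order. [folklore] -/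
theorem even_order_of_expSum_nonneg {ι : Type*} [Fintype ι] (a x : ι → ℝ) (hle : ∀ t, 0 ≤ expSum a x t) (z : ℝ) (k : ℕ)
    (hvan : ∀ j < k, expSum (fun i => a i * x i ^ j) x z = 0) (hk : expSum (fun i => a i * x i ^ k) x z ≠ 0) : Even k := by
  have hneg : ∀ j, expSum (fun i => (-a i) * x i ^ j) x z = -expSum (fun i => a i * x i ^ j) x z := fun j => by
    simp only [Bubbling.expSum, neg_mul, Finset.sum_neg_distrib]
  refine even_order_of_expSum_nonpos (fun i => -a i) x (fun t => ?_) z k (fun j hj => by rw [hneg, hvan j hj, neg_zero])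
    (by rw [hneg, neg_ne_zero]; exact hk)
  have : expSum (fun i => -a i) x t = -expSum a x t := by simp only [Bubbling.expSum, neg_mul, Finset.sum_neg_distrib]
  rw [this, neg_nonpos]; exact hle t

/-- **Null letters force `det ≤ 0`.**  If a non-zero singular symmetric `p` is `polar`-orthogonal to every (symmetric) letter `S l`, then every
real combination `Σ_l c_l • S l` lies in the tangent plane of the null cone at `p`, hence has `det ≤ 0`. [folklore] -/
theorem det_nonpos_of_letters_polar_eq_zero {ι : Type*} [Fintype ι] (p : Matrix (Fin 2) (Fin 2) ℝ) (hp : p.IsSymm) (hdet : p.det = 0)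
    (hne : p ≠ 0) (S : ι → Matrix (Fin 2) (Fin 2) ℝ) (hS : ∀ l, (S l).IsSymm) (hpol : ∀ l, (p + S l).det - p.det - (S l).det = 0)
    (c : ι → ℝ) : (∑ l, c l • S l).det ≤ 0 := by
  have hsymm : (∑ l, c l • S l).IsSymm := by
    unfold Matrix.IsSymm
    rw [Matrix.transpose_sum]
    exact Finset.sum_congr rfl fun l _ => by rw [Matrix.transpose_smul, (hS l).eq]
  refine det_nonpos_of_polar_eq_zero p _ hp hsymm hdet hne ?_
  -- the polar form is linear in the second argument (explicit `2 × 2` computation)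
  have hlin : ∀ Q : Matrix (Fin 2) (Fin 2) ℝ, (p + Q).det - p.det - Q.det = p 0 0 * Q 1 1 + Q 0 0 * p 1 1 - p 0 1 * Q 1 0 - Q 0 1 * p 1 0 := by
    intro Q
    simp only [Matrix.det_fin_two, Matrix.add_apply]
    ring
  rw [hlin]
  have hl : ∀ l, p 0 0 * S l 1 1 + S l 0 0 * p 1 1 - p 0 1 * S l 1 0 - S l 0 1 * p 1 0 = 0 := fun l => by rw [← hlin]; exact hpol l
  simp only [Matrix.sum_apply, Matrix.smul_apply, smul_eq_mul, Finset.mul_sum, Finset.sum_mul, ← Finset.sum_add_distrib,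
    ← Finset.sum_sub_distrib]
  refine Finset.sum_eq_zero fun l _ => ?_
  have := hl l
  calc p 0 0 * (c l * S l 1 1) + c l * S l 0 0 * p 1 1 - p 0 1 * (c l * S l 1 0) - c l * S l 0 1 * p 1 0
      = c l * (p 0 0 * S l 1 1 + S l 0 0 * p 1 1 - p 0 1 * S l 1 0 - S l 0 1 * p 1 0) := by ring
    _ = 0 := by rw [this, mul_zero]

end Summit.ValiantsHypothesis.ValiantsHypothesis.Theorems.LacunarySymmetroidMatrixDescartes.WallBubbling
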